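import Summits.MatrixMultiplication.OmegaCensus.DicyclicN1General
import Summits.MatrixMultiplication.OmegaCensus.DicyclicN2General
import Summits.MatrixMultiplication.OmegaCensus.DicyclicN3General
import Summits.MatrixMultiplication.OmegaCensus.DicyclicClassBGeneral
import Summits.MatrixMultiplication.OmegaCensus.DicyclicLawTwoGroupQuotient
import HarnessLib

/-!
# The dicyclic law `3|S||T||U| + 16 = 8|A|` is not attained for ANY `A/⟨c₀⟩` of `2`-rank `≥ 3`

ω-census `pub-omega`, family (b3), seat pub-omega-group gen 13.  Framing: lottery ticket; floor = certified bounds/negative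
ranges.  VALUE: a kernel classification theorem about the group-theoretic method (TPP capacity of dihedral-like groups);
NOT progress on ω.

Gen 12's `no_dicyclic_law_of_two_group_quot` (`DicyclicLawTwoGroupQuotient.lean`) assumed that `B = A/⟨c₀⟩` is a `2`-GROUP
(`2^m · B = 0`).  The five shape classes are now dead without it — P1 (`no_dicyclic_law_of_two_domino'`), N2
(`no_n2_dicyclic_law_general`), N3 (`no_n3_dicyclic_law_general`), N1 (`no_n1_dicyclic_law_general`), B
(`no_classB_dicyclic_law_general`) — by the gen-13 toolkit: restriction to an index-`2` subgroup
(`DicyclicSubgroupRestriction`), the unit trick and the real-character parity over `Ψ = (ψ₁,ψ₂,ψ₃) : A → 𝔽₂³`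
(`DicyclicParityTools`, `DicyclicClassBGeneralCore/Parseval`), and gen 12's N1 chain with a supplied killing character
(`DicyclicN1GeneralChain/Cosets`).  The assembly below is gen 12's, verbatim up to the class theorems it calls.

**Theorem (`no_dicyclic_law_of_rank_three_quot`).** Dicyclic type `G(A, c₀)` (`c₀ ≠ 0`), `|A| ≥ 50`, three homomorphisms
`A →+ ZMod 2` killing `c₀` jointly onto `𝔽₂³`, `π : A →+ B` onto with kernel `{0, c₀}` (ANY finite abelian `B`): no TPP
triple attains `3|S||T||U| + 16 = 8|A|`.

Consequently (with g11's `dicyclic_law_iff_of_quot`, the `⟸` half) the classification **'dicyclic law attained ⟺ `A/⟨c₀⟩`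
has a cyclic subgroup of index `≤ 2`' is a kernel theorem for every dicyclic-type group whose quotient `A/⟨c₀⟩` has `2`-rank
`≥ 3`**, odd parts included: the census families `C₂² × Q_{4m}` (`m ≡ 4 (mod 6)`), `C₂³ × Q_{4m}` (`m ≡ 2 (mod 3)`),
`C₂² × (ℤ_n ⋊ ℤ₄)` (`n ≡ 4 (mod 6)`) do NOT attain the dicyclic law `8⌊|A|/3⌋` for ALL such `m, n` with `|A| ≥ 50`
(hence `β ≤ 8⌊|A|/3⌋ − 4` by `tpp_volume_mod_two_gap12`).
-/

namespace Summit.MatrixMultiplication.OmegaCensus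

open Literature.Combinatorics.Additive Finset

section Assembly

variable {A : Type} [AddCommGroup A] [DecidableEq A] [Fintype A] {G : Type} [Group G] [DecidableEq G]
  {ρ τ : A → G} {c₀ : A} {B : Type} [AddCommGroup B] [DecidableEq B] [Fintype B]

/-- **Core of the assembly: `S` and `T` balanced** — any quotient `A/⟨c₀⟩` of `2`-rank `≥ 3`, `|A| ≥ 50`: no TPP triple with
`|S₀| = |S₁|` and `|T₀| = |T₁|` attains the dicyclic law. [folklore] -/
theorem no_dicyclic_law_of_two_balanced_general
    (hρρ : ∀ a b, ρ a * ρ b = ρ (a + b)) (hρτ : ∀ a b, ρ a * τ b = τ (b - a))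
    (hτρ : ∀ a b, τ a * ρ b = τ (a + b)) (hττ : ∀ a b, τ a * τ b = ρ (c₀ + b - a)) (hc₀ : c₀ ≠ 0)
    (hρ : Function.Injective ρ) (hτ : Function.Injective τ) (hne : ∀ a b, ρ a ≠ τ b)
    (hsurj : ∀ g, (∃ a, ρ a = g) ∨ (∃ a, τ a = g)) (hA : 50 ≤ Fintype.card A)
    (ψ₁ ψ₂ ψ₃ : A →+ ZMod 2) (hψc : ψ₁ c₀ = 0 ∧ ψ₂ c₀ = 0 ∧ ψ₃ c₀ = 0)
    (hψ : ∀ v : ZMod 2 × ZMod 2 × ZMod 2, ∃ x, (ψ₁ x, ψ₂ x, ψ₃ x) = v)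
    (π : A →+ B) (hπ : Function.Surjective π) (hker : ∀ a : A, π a = 0 ↔ a = 0 ∨ a = c₀)
    {S T U : Finset G} (h : TripleProductProperty S T U)
    (hs : (univ.filter fun a : A => ρ a ∈ S).card = (univ.filter fun a : A => τ a ∈ S).card)
    (ht : (univ.filter fun a : A => ρ a ∈ T).card = (univ.filter fun a : A => τ a ∈ T).card) :
    3 * (S.card * T.card * U.card) + 16 ≠ 8 * Fintype.card A := by
  intro hV
  have hmod : Fintype.card A % 3 = 2 := by omega
  have hA28 : 28 ≤ Fintype.card A := by omega
  obtain ⟨s, hs₀⟩ : ∃ s, (univ.filter fun a : A => ρ a ∈ S).card = s := ⟨_, rfl⟩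
  obtain ⟨t, ht₀⟩ : ∃ t, (univ.filter fun a : A => ρ a ∈ T).card = t := ⟨_, rfl⟩
  obtain ⟨u₀, hu₀⟩ : ∃ u, (univ.filter fun a : A => ρ a ∈ U).card = u := ⟨_, rfl⟩
  obtain ⟨u₁, hu₁⟩ : ∃ u, (univ.filter fun a : A => τ a ∈ U).card = u := ⟨_, rfl⟩
  have hs₁ : (univ.filter fun a : A => τ a ∈ S).card = s := by rw [← hs, hs₀]
  have ht₁ : (univ.filter fun a : A => τ a ∈ T).card = t := by rw [← ht, ht₀]
  have cS : S.card = s + s := by rw [card_eq_parts' hρ hτ hne hsurj S, hs₀, hs₁]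
  have cT : T.card = t + t := by rw [card_eq_parts' hρ hτ hne hsurj T, ht₀, ht₁]
  have cU : U.card = u₀ + u₁ := by rw [card_eq_parts' hρ hτ hne hsurj U, hu₀, hu₁]
  obtain ⟨h000, h111, -⟩ := vertex_counting' hρρ hρτ hτρ hττ hρ hτ hne h
  rw [hs₀, hs₁, ht₀, ht₁, hu₀, hu₁] at h000 h111
  have hV' := hV
  rw [cS, cT, cU] at hV'
  obtain ⟨q, hq⟩ := eight_dvd_card_of_onto ψ₁ ψ₂ ψ₃ hψ
  -- the unbalance `d` of `U` and the bound `s t d ≤ 4`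
  obtain ⟨d, hd, hstd⟩ : ∃ d, (u₀ = u₁ + d ∨ u₁ = u₀ + d) ∧ s * t * d ≤ 4 := by
    rcases le_total u₁ u₀ with hle | hle
    · obtain ⟨d, rfl⟩ := Nat.exists_eq_add_of_le hle
      refine ⟨d, Or.inl rfl, ?_⟩
      have e1 : s * t * (u₁ + d) = s * t * u₁ + s * t * d := by ring
      have e2 : (s + s) * (t + t) * (u₁ + d + u₁) = 8 * (s * t * u₁) + 4 * (s * t * d) := by ring
      rw [e1] at h000; rw [e2] at hV'; omega
    · obtain ⟨d, rfl⟩ := Nat.exists_eq_add_of_le hle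
      refine ⟨d, Or.inr rfl, ?_⟩
      have e1 : s * t * (u₀ + d) = s * t * u₀ + s * t * d := by ring
      have e2 : (s + s) * (t + t) * (u₀ + (u₀ + d)) = 8 * (s * t * u₀) + 4 * (s * t * d) := by ring
      rw [e1] at h111; rw [e2] at hV'; omega
  -- class B
  rcases Nat.eq_zero_or_pos d with rfl | hdpos
  · have hu : (univ.filter fun a : A => ρ a ∈ U).card = (univ.filter fun a : A => τ a ∈ U).card := by
      rw [hu₀, hu₁]; omega
    exact no_classB_dicyclic_law_general hρρ hρτ hτρ hττ hc₀ hρ hτ hne hsurj ψ₁ ψ₂ ψ₃ hψc hψ h hs ht hu hV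
  have hU : (univ.filter fun a : A => ρ a ∈ U).card ≠ (univ.filter fun a : A => τ a ∈ U).card := by
    rw [hu₀, hu₁]; omega
  have hst : s * t ≤ 4 := le_trans (Nat.le_mul_of_pos_right _ hdpos) hstd
  -- `s, t ≥ 1`
  rcases Nat.eq_zero_or_pos s with rfl | hspos
  · simp at hV'; omega
  rcases Nat.eq_zero_or_pos t with rfl | htpos
  · simp at hV'; omega
  have hs4 : s ≤ 4 := le_trans (Nat.le_mul_of_pos_right _ htpos) hst
  have ht4 : t ≤ 4 := le_trans (Nat.le_mul_of_pos_left _ hspos) hst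
  interval_cases s <;> interval_cases t
  all_goals first
    | omega
    | -- two dominoes
      exact no_dicyclic_law_of_two_domino' hρρ hρτ hτρ hττ hc₀ hρ hτ hne hsurj hmod hA28 ψ₁ ψ₂ ψ₃ hψc hψ h hs₀ hs₁
        ht₀ ht₁ hV
    | -- class N1, roles `(S, T, U)`
      exact no_n1_dicyclic_law_general hρρ hρτ hτρ hττ hc₀ hρ hτ hne hsurj hmod hA28 ψ₁ ψ₂ ψ₃ hψc hψ π hπ hker h hs₀
        hs₁ ht₀ ht₁ hU hV
    | -- class N1, roles `(T, S, U)`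
      exact no_n1_dicyclic_law_general hρρ hρτ hτρ hττ hc₀ hρ hτ hne hsurj hmod hA28 ψ₁ ψ₂ ψ₃ hψc hψ π hπ hker
        (tpp_reverse h).rotate ht₀ ht₁ hs₀ hs₁ hU
        (by rw [show T.card * S.card * U.card = S.card * T.card * U.card by ring]; exact hV)
    | -- class N3
      exact no_n3_dicyclic_law_general hρρ hρτ hτρ hττ hc₀ hρ hτ hne hsurj hmod hA28 ψ₁ ψ₂ ψ₃ hψc hψ h hs₀ hs₁
        ht₀ ht₁ hV
    | -- class N2, roles `(S, U, T)`
      exact no_n2_dicyclic_law_general hρρ hρτ hτρ hττ hc₀ hρ hτ hne hsurj hmod hA28 ψ₁ ψ₂ ψ₃ hψc hψ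
        (tpp_reverse h).rotate.rotate hs₀ hs₁ ht₀ ht₁
        (by rw [show S.card * U.card * T.card = S.card * T.card * U.card by ring]; exact hV)
    | -- class N2, roles `(T, U, S)`
      exact no_n2_dicyclic_law_general hρρ hρτ hτρ hττ hc₀ hρ hτ hne hsurj hmod hA28 ψ₁ ψ₂ ψ₃ hψc hψ
        h.rotate ht₀ ht₁ hs₀ hs₁
        (by rw [show T.card * U.card * S.card = S.card * T.card * U.card by ring]; exact hV)

/-- **The dicyclic law is not attained when `A/⟨c₀⟩` maps onto `𝔽₂³`** — no `2`-group hypothesis (`|A| ≥ 50`; see the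
module docstring).  For every TPP triple `(S, T, U)` of `G(A, c₀)`: `3|S||T||U| + 16 ≠ 8|A|`. [folklore] -/
theorem no_dicyclic_law_of_rank_three_quot
    (hρρ : ∀ a b, ρ a * ρ b = ρ (a + b)) (hρτ : ∀ a b, ρ a * τ b = τ (b - a))
    (hτρ : ∀ a b, τ a * ρ b = τ (a + b)) (hττ : ∀ a b, τ a * τ b = ρ (c₀ + b - a)) (hc₀ : c₀ ≠ 0)
    (hρ : Function.Injective ρ) (hτ : Function.Injective τ) (hne : ∀ a b, ρ a ≠ τ b)
    (hsurj : ∀ g, (∃ a, ρ a = g) ∨ (∃ a, τ a = g)) (hA : 50 ≤ Fintype.card A)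
    (ψ₁ ψ₂ ψ₃ : A →+ ZMod 2) (hψc : ψ₁ c₀ = 0 ∧ ψ₂ c₀ = 0 ∧ ψ₃ c₀ = 0)
    (hψ : ∀ v : ZMod 2 × ZMod 2 × ZMod 2, ∃ x, (ψ₁ x, ψ₂ x, ψ₃ x) = v)
    (π : A →+ B) (hπ : Function.Surjective π) (hker : ∀ a : A, π a = 0 ↔ a = 0 ∨ a = c₀)
    {S T U : Finset G} (h : TripleProductProperty S T U) :
    3 * (S.card * T.card * U.card) + 16 ≠ 8 * Fintype.card A := by
  intro hV
  obtain ⟨h000, h111, h100, h011, h010, h101, h001, h110⟩ := vertex_counting' hρρ hρτ hτρ hττ hρ hτ hne h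
  have hV' := hV
  rw [card_eq_parts' hρ hτ hne hsurj S, card_eq_parts' hρ hτ hne hsurj T, card_eq_parts' hρ hτ hne hsurj U] at hV'
  rcases two_balanced_of_vertex_bounds31 _ _ _ _ _ _ _ h000 h111 h100 h011 h010 h101 h001 h110 (by omega)
      (by omega) with ⟨hs, ht⟩ | ⟨hs, hu⟩ | ⟨ht, hu⟩
  · exact no_dicyclic_law_of_two_balanced_general hρρ hρτ hτρ hττ hc₀ hρ hτ hne hsurj hA ψ₁ ψ₂ ψ₃ hψc hψ π hπ hker h
      hs ht hV
  · -- rotate to `(U, S, T)`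
    have := no_dicyclic_law_of_two_balanced_general hρρ hρτ hτρ hττ hc₀ hρ hτ hne hsurj hA ψ₁ ψ₂ ψ₃ hψc hψ π hπ hker
      h.rotate.rotate hu hs
    exact this (by rw [show U.card * S.card * T.card = S.card * T.card * U.card by ring]; exact hV)
  · -- rotate to `(T, U, S)`
    have := no_dicyclic_law_of_two_balanced_general hρρ hρτ hτρ hττ hc₀ hρ hτ hne hsurj hA ψ₁ ψ₂ ψ₃ hψc hψ π hπ hker
      h.rotate ht hu
    exact this (by rw [show T.card * U.card * S.card = S.card * T.card * U.card by ring]; exact hV)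

end Assembly

end Summit.MatrixMultiplication.OmegaCensus
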